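import Summits.QuantumFields.BalabanUV.Beta.GAN24.PairingCellTransfer

/-!
# `BalabanUV.Beta.GAN24.FaceWordLeftExposure` — binder row G-an2-4 ∕ (CONV-C), W-slot (α-0), ROW (C)sym AT LEVELS `≥ 1` (rows T6-STEP of the OWNER's
# two-index tower, RULING R-gan24p1-g40-1): **THE LEFT FACE CURRENT OF THE EXCHANGE ∕ CONTACT FACE WORD, EXPOSED** — Part 44a of `GAN24/FourFaceGaugeSectors`
# (G-an2-4 CRUX TEAM (2), leaf prover `b2b-balaban-gan24-formalise-leaf-02`, gen 69; journal [LEAF02-G69-ONLINE] INTENT 1; the kinematic half of Part 44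
# `GAN24/FacePairingPairForm`, split off for the 400-line rule)

NOT IN PRINT; OUR BOOKKEEPING ([folklore] dominated Fubini BY NAME over Part 42 `PairingCellTransfer.four_shuffle ∕ abs_faceMask_le`, an4's
`KernelWard.comp_assoc_bdb`, an2's `ExpKernelCalculus.biLoc_comp_decays`; 0 `def`, 0 cited fact, 0 `def … : Prop`, 0 sorry).  HONEST FRAMING (cell contract,
verbatim): «discharging `BetaPertH` makes Bałaban's UV stability UNCONDITIONAL — a real constructive-QFT result; it is NOT the continuum limit and NOT the Clay
problem.»  HONEST DEPENDENCY (verbatim): «continuum YM on T⁴ ⇐ BetaPertH ∧ nine spine estimates (0/9 proved); BetaPertH ⇐ (D1) ∧ (D4) ∧ CAP+tail; G-an2-4 gates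
asym, D1 and NE2/3/4.»

WHAT (generic `d`; ANY local stencil family `S` (`LocStencil S Cs δ`) and decaying kernel `G` (`Decays G CG δ`), common rate `δ > 0`; any integer modulus `N`;
`χ(n) := [n % N = N − 1]`; the right bond `s` fixed).  The face word `Σ'_v χ(v_a)·Σ'_{(y,w)} χ(y_b)χ(w_e)·((S a v ∘ G) ∘ S c s)(y,w)(inl b)(inl e)` (Part 43's
face-pairing literal, the cell bond being the RIGHT one) equals `Σ'_{(x,w)} Σ_f (Σ'_y χ(y_b)·Σ'_v χ(v_a)·S a v y x (inl b) f)·(χ(w_e)·(G ∘ S c s)(x,w)(f, inl e))` —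
the LEFT period-`N` face current of `S` in the weighted-leg-first placement of leaf-04 g69's (A)-tower F5 `CurrentSymTower.sym_SpureRecAt`, read against the
packaged right factor `G ∘ S c s`:
* `summable_majorant_left` (the four-fold majorant is a product of four exponential series after the shear `(y,v) ↦ (y − v, x − v)`), `summable_four_left`
  (four-fold absolute summability of the exposed family), **`word_left_exposure`** (`comp_assoc_bdb` ⨾ `four_shuffle` ⨾ `Summable.tsum_finsetSum`).
USE: Part 44 `FacePairingPairForm.word_left_antisymm ∕ eeWords_eq_pairForm`.  Asserts NO value of any current, pairing or table; discharges NOTHING of (C)_{≥1} ∕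
`hstep` ∕ `hSrc` ∕ `hSrcX` ∕ (Q-L) ∕ (hW, hWall); NEVER «G-an2-4 closed» as (CONV-C); NOT D1, NOT `BetaPertH`, NOT continuum, NOT Clay.  2026-08-24; no existing file touched.
-/

noncomputable section

open Finset
open scoped BigOperators
open Literature.MathematicalPhysics.QuantumFieldTheory
open Literature.MathematicalPhysics.QuantumFieldTheory.Balaban1983to89
open Literature.MathematicalPhysics.QuantumFieldTheory.Balaban1983to89.Beta
open B12Sec2to5 (l1 l1_nonneg)
open ExpKernelCalculus (Site MKer Decays BiLoc comp biLoc_comp_decays Zl Zl_nonneg summable_exp_shift')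
open OneStepResolventKernel (Fib LocStencil)
open KernelWard (comp_assoc_bdb)
open Summit.QuantumFields.BalabanUV.Beta.GAN24.PairingCellTransfer (abs_faceMask_le four_shuffle)

namespace Summit.QuantumFields.BalabanUV.Beta.GAN24.FaceWordLeftExposure

variable {d : ℕ}
variable {S : Fin (d + 1) → Site (d + 1) → MKer (d + 1) (Fib d)} {G : MKer (d + 1) (Fib d)} {Cs CG δ : ℝ}

/-- [folklore] The four-fold majorant `((x,w),(y,v)) ↦ (Cs·e^{−δ|y−v|₁}e^{−δ|x−v|₁})·(C′·e^{−(δ/2)|x−s|₁}e^{−(δ/2)|w−s|₁})` is summable: after the shear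
`(y, v) ↦ (y − v, x − v)` (an equivalence of the index set) it is a product of four shifted exponential series. -/
theorem summable_majorant_left (hδ : 0 < δ) (Cs' C' : ℝ) (s : Site (d + 1)) :
    Summable fun q : (Site (d + 1) × Site (d + 1)) × (Site (d + 1) × Site (d + 1)) =>
      (Cs' * (Real.exp (-δ * l1 (q.2.1 - q.2.2)) * Real.exp (-δ * l1 (q.1.1 - q.2.2)))) *
        (C' * (Real.exp (-(δ / 2) * l1 (q.1.1 - s)) * Real.exp (-(δ / 2) * l1 (q.1.2 - s)))) := by
  -- the shear `((x,w),(y,v)) ↦ ((x,w),(y − v, x − v))`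
  let e : (Site (d + 1) × Site (d + 1)) × (Site (d + 1) × Site (d + 1)) ≃ (Site (d + 1) × Site (d + 1)) × (Site (d + 1) × Site (d + 1)) :=
    { toFun := fun q => (q.1, (q.2.1 - q.2.2, q.1.1 - q.2.2))
      invFun := fun q => (q.1, (q.1.1 - q.2.2 + q.2.1, q.1.1 - q.2.2))
      left_inv := fun q => by
        show (q.1, (q.1.1 - (q.1.1 - q.2.2) + (q.2.1 - q.2.2), q.1.1 - (q.1.1 - q.2.2))) = q
        rw [sub_sub_cancel, add_sub_cancel]
      right_inv := fun q => by
        show (q.1, (q.1.1 - q.2.2 + q.2.1 - (q.1.1 - q.2.2), q.1.1 - (q.1.1 - q.2.2))) = q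
        rw [add_sub_cancel_left, sub_sub_cancel] }
  have h2 : Summable fun y : Site (d + 1) => Real.exp (-(δ / 2) * l1 (y - s)) := summable_exp_shift' (by positivity) s
  have h1 : Summable fun a : Site (d + 1) => Real.exp (-δ * l1 a) := by
    have := summable_exp_shift' hδ (0 : Site (d + 1))
    simpa only [sub_zero] using this
  have hxw : Summable fun xw : Site (d + 1) × Site (d + 1) => Real.exp (-(δ / 2) * l1 (xw.1 - s)) * Real.exp (-(δ / 2) * l1 (xw.2 - s)) :=
    h2.mul_of_nonneg h2 (fun _ => (Real.exp_pos _).le) (fun _ => (Real.exp_pos _).le)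
  have hab : Summable fun ab : Site (d + 1) × Site (d + 1) => Real.exp (-δ * l1 ab.1) * Real.exp (-δ * l1 ab.2) :=
    h1.mul_of_nonneg h1 (fun _ => (Real.exp_pos _).le) (fun _ => (Real.exp_pos _).le)
  have hprod : Summable fun q : (Site (d + 1) × Site (d + 1)) × (Site (d + 1) × Site (d + 1)) =>
      (Real.exp (-(δ / 2) * l1 (q.1.1 - s)) * Real.exp (-(δ / 2) * l1 (q.1.2 - s))) * (Real.exp (-δ * l1 q.2.1) * Real.exp (-δ * l1 q.2.2)) :=
    Summable.mul_of_nonneg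
      (f := fun xw : Site (d + 1) × Site (d + 1) => Real.exp (-(δ / 2) * l1 (xw.1 - s)) * Real.exp (-(δ / 2) * l1 (xw.2 - s)))
      (g := fun ab : Site (d + 1) × Site (d + 1) => Real.exp (-δ * l1 ab.1) * Real.exp (-δ * l1 ab.2)) hxw hab
      (fun xw => mul_nonneg (Real.exp_pos _).le (Real.exp_pos _).le) (fun ab => mul_nonneg (Real.exp_pos _).le (Real.exp_pos _).le)
  have ht : Summable fun q : (Site (d + 1) × Site (d + 1)) × (Site (d + 1) × Site (d + 1)) =>
      (Real.exp (-(δ / 2) * l1 (q.1.1 - s)) * Real.exp (-(δ / 2) * l1 (q.1.2 - s))) *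
        (Real.exp (-δ * l1 (q.2.1 - q.2.2)) * Real.exp (-δ * l1 (q.1.1 - q.2.2))) := by
    have h := (e.summable_iff).2 hprod
    exact h.congr fun q => rfl
  exact (ht.mul_left (Cs' * C')).congr fun q => by ring

/-- [folklore] **FOUR-FOLD ABSOLUTE SUMMABILITY OF THE LEFT-EXPOSED WORD** (local stencil family `S`, decaying `G`, common rate `δ > 0`; masks `≤ 1`; right bond
`s` and fibre leg `f` fixed): the family `((x,w),(y,v)) ↦ χ(v_a)·(χ(y_b)·χ(w_e)·(S a v y x (inl b) f · (G ∘ S c s) x w f (inl e)))` is summable. -/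
theorem summable_four_left (hS : LocStencil S Cs δ) (hG : Decays G CG δ) (hδ : 0 < δ) (N : ℤ) (a b c e : Fin (d + 1)) (s : Site (d + 1)) (f : Fib d) :
    Summable fun q : (Site (d + 1) × Site (d + 1)) × (Site (d + 1) × Site (d + 1)) =>
      (if q.2.2 a % N = N - 1 then (1 : ℝ) else 0) *
        ((if q.2.1 b % N = N - 1 then (1 : ℝ) else 0) * (if q.1.2 e % N = N - 1 then (1 : ℝ) else 0) *
          (S a q.2.2 q.2.1 q.1.1 (Sum.inl b) f * comp G (S c s) q.1.1 q.1.2 f (Sum.inl e))) := by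
  have hCG : 0 ≤ CG := hG.nonneg (Sum.inl a)
  have hCs : 0 ≤ Cs := (hS c s).nonneg (Sum.inl a)
  have hK : BiLoc (comp G (S c s)) s s ((Fintype.card (Fib d) : ℝ) * (CG * Cs) * Zl (d + 1) (δ - δ / 2)) (δ / 2) :=
    biLoc_comp_decays hG (hS c s) (by positivity) (by linarith)
  refine Summable.of_norm_bounded (summable_majorant_left hδ Cs ((Fintype.card (Fib d) : ℝ) * (CG * Cs) * Zl (d + 1) (δ - δ / 2)) s) (fun q => ?_)
  rw [Real.norm_eq_abs]
  have h1 := hS a q.2.2 q.2.1 q.1.1 (Sum.inl b) f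
  have h2 := hK q.1.1 q.1.2 f (Sum.inl e)
  have e1 : |(if q.2.2 a % N = N - 1 then (1 : ℝ) else 0)| ≤ 1 := abs_faceMask_le N q.2.2 a
  have e2 : |(if q.2.1 b % N = N - 1 then (1 : ℝ) else 0)| ≤ 1 := abs_faceMask_le N q.2.1 b
  have e3 : |(if q.1.2 e % N = N - 1 then (1 : ℝ) else 0)| ≤ 1 := abs_faceMask_le N q.1.2 e
  have h0 : 0 ≤ Cs * Real.exp (-δ * (l1 (q.2.1 - q.2.2) + l1 (q.1.1 - q.2.2))) := (abs_nonneg _).trans h1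
  have h0' : 0 ≤ (Fintype.card (Fib d) : ℝ) * (CG * Cs) * Zl (d + 1) (δ - δ / 2) * Real.exp (-(δ / 2) * (l1 (q.1.1 - s) + l1 (q.1.2 - s))) :=
    (abs_nonneg _).trans h2
  rw [abs_mul, abs_mul, abs_mul, abs_mul]
  calc |(if q.2.2 a % N = N - 1 then (1 : ℝ) else 0)| *
        (|(if q.2.1 b % N = N - 1 then (1 : ℝ) else 0)| * |(if q.1.2 e % N = N - 1 then (1 : ℝ) else 0)| *
          (|S a q.2.2 q.2.1 q.1.1 (Sum.inl b) f| * |comp G (S c s) q.1.1 q.1.2 f (Sum.inl e)|))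
      ≤ 1 * (1 * 1 * ((Cs * Real.exp (-δ * (l1 (q.2.1 - q.2.2) + l1 (q.1.1 - q.2.2)))) *
          ((Fintype.card (Fib d) : ℝ) * (CG * Cs) * Zl (d + 1) (δ - δ / 2) * Real.exp (-(δ / 2) * (l1 (q.1.1 - s) + l1 (q.1.2 - s)))))) := by
        refine mul_le_mul e1 (mul_le_mul (mul_le_mul e2 e3 (abs_nonneg _) zero_le_one) (mul_le_mul h1 h2 (abs_nonneg _) h0) ?_ ?_) ?_ zero_le_one
        · exact mul_nonneg (abs_nonneg _) (abs_nonneg _)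
        · exact mul_nonneg zero_le_one zero_le_one
        · exact mul_nonneg (mul_nonneg (abs_nonneg _) (abs_nonneg _)) (mul_nonneg (abs_nonneg _) (abs_nonneg _))
    _ = (Cs * (Real.exp (-δ * l1 (q.2.1 - q.2.2)) * Real.exp (-δ * l1 (q.1.1 - q.2.2)))) *
          (((Fintype.card (Fib d) : ℝ) * (CG * Cs) * Zl (d + 1) (δ - δ / 2)) *
            (Real.exp (-(δ / 2) * l1 (q.1.1 - s)) * Real.exp (-(δ / 2) * l1 (q.1.2 - s)))) := by
        rw [one_mul, one_mul, one_mul, mul_add, Real.exp_add, mul_add (-(δ / 2)), Real.exp_add]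

/-- NOT IN PRINT; OUR BOOKKEEPING.  **THE LEFT EXPOSURE** (local stencil family `S`, decaying `G`, common rate `δ > 0`, any integer modulus, right bond `s` fixed):
`Σ'_v χ(v_a)·Σ'_{(y,w)} χ(y_b)χ(w_e)·((S a v ∘ G) ∘ S c s)(y,w)(inl b)(inl e)
   = Σ'_{(x,w)} Σ_f (Σ'_y χ(y_b)·Σ'_v χ(v_a)·S a v y x (inl b) f)·(χ(w_e)·(G ∘ S c s)(x,w)(f, inl e))`
— the LEFT face current of `S` in the weighted-leg-first placement of leaf-04 F5 `sym_SpureRecAt`, read against the packaged right factor `G ∘ S c s`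
(`comp_assoc_bdb`, four-fold absolute summability `summable_four_left`, Part 42 `four_shuffle`, the finite fibre sum through `Summable.tsum_finsetSum`). -/
theorem word_left_exposure (hS : LocStencil S Cs δ) (hG : Decays G CG δ) (hδ : 0 < δ) (N : ℤ) (a b c e : Fin (d + 1)) (s : Site (d + 1)) :
    ∑' v : Site (d + 1), (if v a % N = N - 1 then (1 : ℝ) else 0) *
        ∑' yw : Site (d + 1) × Site (d + 1), (if yw.1 b % N = N - 1 then (1 : ℝ) else 0) * (if yw.2 e % N = N - 1 then (1 : ℝ) else 0) *
          comp (comp (S a v) G) (S c s) yw.1 yw.2 (Sum.inl b) (Sum.inl e)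
      = ∑' xw : Site (d + 1) × Site (d + 1), ∑ f : Fib d,
          (∑' y : Site (d + 1), (if y b % N = N - 1 then (1 : ℝ) else 0) *
              ∑' v : Site (d + 1), (if v a % N = N - 1 then (1 : ℝ) else 0) * S a v y xw.1 (Sum.inl b) f) *
            ((if xw.2 e % N = N - 1 then (1 : ℝ) else 0) * comp G (S c s) xw.1 xw.2 f (Sum.inl e)) := by
  classical
  -- associativity: package the right factor `G ∘ S c s`
  have hassoc : ∀ v : Site (d + 1), comp (comp (S a v) G) (S c s) = comp (S a v) (comp G (S c s)) :=
    fun v => (comp_assoc_bdb (hS a v) hG (hS c s) hδ).symm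
  simp_rw [hassoc]
  -- the four-fold family per fibre leg `f`, indexed by `((x,w),(y,v))`
  have hF := fun f : Fib d => summable_four_left hS hG hδ N a b c e s f
  -- its re-indexing `((y,z),(w,t)) ↦ ((z,w),(y,t))` for `four_shuffle`
  let ι : (Site (d + 1) × Site (d + 1)) × (Site (d + 1) × Site (d + 1)) ≃ (Site (d + 1) × Site (d + 1)) × (Site (d + 1) × Site (d + 1)) :=
    { toFun := fun q => ((q.1.2, q.2.1), (q.1.1, q.2.2))
      invFun := fun q => ((q.2.1, q.1.1), (q.1.2, q.2.2))
      left_inv := fun _ => rfl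
      right_inv := fun _ => rfl }
  have hΦ : ∀ f : Fib d, Summable fun q : (Site (d + 1) × Site (d + 1)) × (Site (d + 1) × Site (d + 1)) =>
      (if (ι q).2.2 a % N = N - 1 then (1 : ℝ) else 0) *
        ((if (ι q).2.1 b % N = N - 1 then (1 : ℝ) else 0) * (if (ι q).1.2 e % N = N - 1 then (1 : ℝ) else 0) *
          (S a (ι q).2.2 (ι q).2.1 (ι q).1.1 (Sum.inl b) f * comp G (S c s) (ι q).1.1 (ι q).1.2 f (Sum.inl e))) :=
    fun f => (ι.summable_iff).2 (hF f)
  -- LEFT side = `Σ_f Σ' q, F_f q`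
  have hLHS : ∑' v : Site (d + 1), (if v a % N = N - 1 then (1 : ℝ) else 0) *
        ∑' yw : Site (d + 1) × Site (d + 1), (if yw.1 b % N = N - 1 then (1 : ℝ) else 0) * (if yw.2 e % N = N - 1 then (1 : ℝ) else 0) *
          comp (S a v) (comp G (S c s)) yw.1 yw.2 (Sum.inl b) (Sum.inl e)
      = ∑ f : Fib d, ∑' q : (Site (d + 1) × Site (d + 1)) × (Site (d + 1) × Site (d + 1)),
          (if q.2.2 a % N = N - 1 then (1 : ℝ) else 0) *
            ((if q.2.1 b % N = N - 1 then (1 : ℝ) else 0) * (if q.1.2 e % N = N - 1 then (1 : ℝ) else 0) *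
              (S a q.2.2 q.2.1 q.1.1 (Sum.inl b) f * comp G (S c s) q.1.1 q.1.2 f (Sum.inl e))) := by
    -- unfold the composition and pull the masks inside: `Σ'_v Σ'_{yw} Σ'_x Σ_f F_f((x,w),(y,v))`
    have step1 : ∀ v : Site (d + 1), (if v a % N = N - 1 then (1 : ℝ) else 0) *
        ∑' yw : Site (d + 1) × Site (d + 1), (if yw.1 b % N = N - 1 then (1 : ℝ) else 0) * (if yw.2 e % N = N - 1 then (1 : ℝ) else 0) *
          comp (S a v) (comp G (S c s)) yw.1 yw.2 (Sum.inl b) (Sum.inl e)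
        = ∑' yw : Site (d + 1) × Site (d + 1), ∑' x : Site (d + 1), ∑ f : Fib d,
          (if v a % N = N - 1 then (1 : ℝ) else 0) *
            ((if yw.1 b % N = N - 1 then (1 : ℝ) else 0) * (if yw.2 e % N = N - 1 then (1 : ℝ) else 0) *
              (S a v yw.1 x (Sum.inl b) f * comp G (S c s) x yw.2 f (Sum.inl e))) := by
      intro v
      rw [← tsum_mul_left]
      refine tsum_congr fun yw => ?_
      unfold ExpKernelCalculus.comp
      rw [← tsum_mul_left, ← tsum_mul_left]
      refine tsum_congr fun x => ?_
      rw [Finset.mul_sum, Finset.mul_sum]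
    simp_rw [step1]
    -- re-order by `four_shuffle` (per fibre) and move the finite fibre sum outside
    have hB := fun f : Fib d => (four_shuffle (hΦ f)).1
    -- the three summabilities of `four_shuffle`, read through the re-indexing `ι` (definitional unfolding)
    have hSo : ∀ f : Fib d, Summable fun v : Site (d + 1) => ∑' yw : Site (d + 1) × Site (d + 1), ∑' x : Site (d + 1),
        (if v a % N = N - 1 then (1 : ℝ) else 0) *
          ((if yw.1 b % N = N - 1 then (1 : ℝ) else 0) * (if yw.2 e % N = N - 1 then (1 : ℝ) else 0) *
            (S a v yw.1 x (Sum.inl b) f * comp G (S c s) x yw.2 f (Sum.inl e))) :=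
      fun f => (four_shuffle (hΦ f)).2.1
    have hSm : ∀ (f : Fib d) (v : Site (d + 1)), Summable fun yw : Site (d + 1) × Site (d + 1) => ∑' x : Site (d + 1),
        (if v a % N = N - 1 then (1 : ℝ) else 0) *
          ((if yw.1 b % N = N - 1 then (1 : ℝ) else 0) * (if yw.2 e % N = N - 1 then (1 : ℝ) else 0) *
            (S a v yw.1 x (Sum.inl b) f * comp G (S c s) x yw.2 f (Sum.inl e))) :=
      fun f => (four_shuffle (hΦ f)).2.2.1
    have hSi : ∀ (f : Fib d) (v : Site (d + 1)) (yw : Site (d + 1) × Site (d + 1)), Summable fun x : Site (d + 1) =>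
        (if v a % N = N - 1 then (1 : ℝ) else 0) *
          ((if yw.1 b % N = N - 1 then (1 : ℝ) else 0) * (if yw.2 e % N = N - 1 then (1 : ℝ) else 0) *
            (S a v yw.1 x (Sum.inl b) f * comp G (S c s) x yw.2 f (Sum.inl e))) :=
      fun f => (four_shuffle (hΦ f)).2.2.2
    have hE : ∀ f : Fib d, ∑' q : (Site (d + 1) × Site (d + 1)) × (Site (d + 1) × Site (d + 1)),
          (if q.2.2 a % N = N - 1 then (1 : ℝ) else 0) *
            ((if q.2.1 b % N = N - 1 then (1 : ℝ) else 0) * (if q.1.2 e % N = N - 1 then (1 : ℝ) else 0) *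
              (S a q.2.2 q.2.1 q.1.1 (Sum.inl b) f * comp G (S c s) q.1.1 q.1.2 f (Sum.inl e)))
        = ∑' v : Site (d + 1), ∑' yw : Site (d + 1) × Site (d + 1), ∑' x : Site (d + 1),
          (if v a % N = N - 1 then (1 : ℝ) else 0) *
            ((if yw.1 b % N = N - 1 then (1 : ℝ) else 0) * (if yw.2 e % N = N - 1 then (1 : ℝ) else 0) *
              (S a v yw.1 x (Sum.inl b) f * comp G (S c s) x yw.2 f (Sum.inl e))) := by
      intro f
      rw [← ι.tsum_eq, hB f]
      rfl
    simp_rw [hE]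
    rw [← Summable.tsum_finsetSum (fun f _ => hSo f)]
    refine tsum_congr fun v => ?_
    rw [← Summable.tsum_finsetSum (fun f _ => hSm f v)]
    refine tsum_congr fun yw => ?_
    rw [← Summable.tsum_finsetSum (fun f _ => hSi f v yw)]
  -- RIGHT side = `Σ_f Σ' q, F_f q`
  have hRHS : ∑' xw : Site (d + 1) × Site (d + 1), ∑ f : Fib d,
        (∑' y : Site (d + 1), (if y b % N = N - 1 then (1 : ℝ) else 0) *
            ∑' v : Site (d + 1), (if v a % N = N - 1 then (1 : ℝ) else 0) * S a v y xw.1 (Sum.inl b) f) *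
          ((if xw.2 e % N = N - 1 then (1 : ℝ) else 0) * comp G (S c s) xw.1 xw.2 f (Sum.inl e))
      = ∑ f : Fib d, ∑' q : (Site (d + 1) × Site (d + 1)) × (Site (d + 1) × Site (d + 1)),
          (if q.2.2 a % N = N - 1 then (1 : ℝ) else 0) *
            ((if q.2.1 b % N = N - 1 then (1 : ℝ) else 0) * (if q.1.2 e % N = N - 1 then (1 : ℝ) else 0) *
              (S a q.2.2 q.2.1 q.1.1 (Sum.inl b) f * comp G (S c s) q.1.1 q.1.2 f (Sum.inl e))) := by
    have step2 : ∀ (xw : Site (d + 1) × Site (d + 1)) (f : Fib d),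
        (∑' y : Site (d + 1), (if y b % N = N - 1 then (1 : ℝ) else 0) *
            ∑' v : Site (d + 1), (if v a % N = N - 1 then (1 : ℝ) else 0) * S a v y xw.1 (Sum.inl b) f) *
          ((if xw.2 e % N = N - 1 then (1 : ℝ) else 0) * comp G (S c s) xw.1 xw.2 f (Sum.inl e))
        = ∑' y : Site (d + 1), ∑' v : Site (d + 1),
          (if v a % N = N - 1 then (1 : ℝ) else 0) *
            ((if y b % N = N - 1 then (1 : ℝ) else 0) * (if xw.2 e % N = N - 1 then (1 : ℝ) else 0) *
              (S a v y xw.1 (Sum.inl b) f * comp G (S c s) xw.1 xw.2 f (Sum.inl e))) := by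
      intro xw f
      rw [← tsum_mul_right]
      refine tsum_congr fun y => ?_
      rw [← tsum_mul_left, ← tsum_mul_right]
      refine tsum_congr fun v => ?_
      ring
    simp_rw [step2]
    have hpair : ∀ f : Fib d, Summable fun xw : Site (d + 1) × Site (d + 1) => ∑' y : Site (d + 1), ∑' v : Site (d + 1),
        (if v a % N = N - 1 then (1 : ℝ) else 0) *
          ((if y b % N = N - 1 then (1 : ℝ) else 0) * (if xw.2 e % N = N - 1 then (1 : ℝ) else 0) *
            (S a v y xw.1 (Sum.inl b) f * comp G (S c s) xw.1 xw.2 f (Sum.inl e))) := by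
      intro f
      exact ((hF f).prod).congr fun xw => ((hF f).prod_factor xw).tsum_prod
    rw [Summable.tsum_finsetSum (fun f _ => hpair f)]
    refine Finset.sum_congr rfl fun f _ => ?_
    rw [(hF f).tsum_prod]
    exact tsum_congr fun xw => ((hF f).prod_factor xw).tsum_prod.symm
  rw [hLHS, hRHS]

end Summit.QuantumFields.BalabanUV.Beta.GAN24.FaceWordLeftExposure

end
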